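import Summits.ValiantsHypothesis.ValiantsHypothesis.Theorems.DivisionGapSquareGridDimersDivisionEasyBridge

/-!
# The square grid inside the Aztec diamond: coordinates

The `(2k+2) × (2k+2)` square grid is the induced subgraph of the Aztec diamond graph of order `2k+1`
on its central vertices (Propp 2003, §1.2, first example).  This file sets up the embedding `ψ`, the
grid coordinates `gH`, `gV` of the endpoints of an Aztec edge, and proves that grid adjacency (the
item's four disjuncts `Adj4`) is exactly "being the two endpoints of an Aztec edge with both endpoints
in range" (`exists_edge_of_adj4`, `adj4_of_edge`). [cite: Propp2003, §1.2]

All `def … : Prop` declarations in this file are decidable predicates on finite data (not named facts).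
Support file for `SquareGridDimersDivisionEasy` (route DivisionGap, item stmt-ValiantsHypothesis-5072);
the closing theorem is `squareGridDimersDivisionEasy_proof` in `…DivisionGapSquareGridDimersDivisionEasy.lean`.
-/

namespace Summit.ValiantsHypothesis.ValiantsHypothesis.Theorems

namespace SquareGridDimers

set_option linter.dupNamespace false

noncomputable section

open Finset

/-! ## The square grid inside the Aztec diamond

The `(2k+2) × (2k+2)` square grid is the induced subgraph of the Aztec diamond graph of order
`2k+1` on its central vertices (Propp 2003, §1.2, first example: "for any n, one can assign a
0,1-weighting to the edges of the Aztec diamond graph of order 2n-1 so that the matchings of positive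
weight correspond to the matchings of the 2n-by-2n square grid"). -/

section Square

variable (kk : ℕ)

/-- Vertices of the `(2k+2) × (2k+2)` square grid, as in the item. [cite: Propp2003, §1.2] -/
abbrev GV : Type := Fin (2 * kk + 2) × Fin (2 * kk + 2)

/-- The item's adjacency on `Fin N × Fin N` (edges `(i,j)–(i+1,j)` and `(i,j)–(i,j+1)`), verbatim. [folklore] -/
def Adj4 {N : ℕ} (v w : Fin N × Fin N) : Prop :=
  ((v.1 : ℕ) + 1 = w.1 ∧ (v.2 : ℕ) = w.2) ∨ (((w.1 : ℕ) + 1 = v.1 ∧ (v.2 : ℕ) = w.2) ∨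
    (((v.1 : ℕ) = w.1 ∧ (v.2 : ℕ) + 1 = w.2) ∨ ((v.1 : ℕ) = w.1 ∧ ((w.2 : ℕ) + 1 = v.2))))

/-- The item's adjacency is decidable. [folklore] -/
instance {N : ℕ} (v w : Fin N × Fin N) : Decidable (Adj4 v w) := by unfold Adj4; infer_instance

/-- The embedding of the square grid into the Aztec diamond of order `2k+1` (the grid drawn
diagonally: vertex `(r, s)` goes to the lattice point `(r+s-n, r-s)`). [cite: Propp2003, §1.2] -/
def ψ (v : GV kk) : V (2 * kk + 1) :=
  if (v.1.val + v.2.val) % 2 = 0 then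
    Sum.inl (⟨(v.1.val + v.2.val) / 2, by omega⟩, ⟨(v.1.val + 2 * kk - v.2.val) / 2, by omega⟩)
  else
    Sum.inr (⟨(v.1.val + v.2.val - 1) / 2, by omega⟩, ⟨(v.1.val + 2 * kk + 1 - v.2.val) / 2, by omega⟩)

/-- Grid coordinates (possibly out of range) of the horizontal endpoint of an edge. [folklore] -/
def gH (e : E (2 * kk + 1)) : ℤ × ℤ :=
  ((e.1.1.val : ℤ) + e.1.2.val + e.2.1.val - kk, (e.1.1.val : ℤ) - e.1.2.val + e.2.1.val + kk)

/-- Grid coordinates (possibly out of range) of the vertical endpoint of an edge. [folklore] -/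
def gV (e : E (2 * kk + 1)) : ℤ × ℤ :=
  ((e.1.1.val : ℤ) + e.1.2.val + e.2.2.val - kk, (e.1.1.val : ℤ) - e.1.2.val - e.2.2.val + kk + 1)

/-- A pair of integers is a grid vertex. [folklore] -/
def InRange (z : ℤ × ℤ) : Prop := 0 ≤ z.1 ∧ z.1 < 2 * kk + 2 ∧ 0 ≤ z.2 ∧ z.2 < 2 * kk + 2

/-- `InRange` is decidable. [folklore] -/
instance (z : ℤ × ℤ) : Decidable (InRange kk z) := by unfold InRange; infer_instance

/-- Clamp a pair of integers to a grid vertex (the identity on grid vertices). [folklore] -/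
def toGV (z : ℤ × ℤ) : GV kk :=
  (⟨z.1.toNat % (2 * kk + 2), Nat.mod_lt _ (by omega)⟩, ⟨z.2.toNat % (2 * kk + 2), Nat.mod_lt _ (by omega)⟩)

variable {kk}

/-- When `ψ v` is a given W/E-type vertex. [folklore] -/
theorem ψ_eq_inl_iff (v : GV kk) (x : Fin (2 * kk + 1 + 1)) (y : Fin (2 * kk + 1)) :
    ψ kk v = Sum.inl (x, y) ↔ (v.1.val + v.2.val) % 2 = 0 ∧ (v.1.val + v.2.val) / 2 = x.val ∧
      (v.1.val + 2 * kk - v.2.val) / 2 = y.val := by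
  unfold ψ
  split_ifs with h
  · simp [h, Fin.ext_iff]
  · simp [h]

/-- When `ψ v` is a given S/N-type vertex. [folklore] -/
theorem ψ_eq_inr_iff (v : GV kk) (p : Fin (2 * kk + 1)) (y : Fin (2 * kk + 1 + 1)) :
    ψ kk v = Sum.inr (p, y) ↔ (v.1.val + v.2.val) % 2 = 1 ∧ (v.1.val + v.2.val - 1) / 2 = p.val ∧
      (v.1.val + 2 * kk + 1 - v.2.val) / 2 = y.val := by
  unfold ψ
  split_ifs with h
  · simp [h]
  · simp [Fin.ext_iff, Nat.mod_two_ne_zero.mp h]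

/-- `toGV` on grid vertices. [folklore] -/
theorem toGV_val (z : ℤ × ℤ) (h : InRange kk z) :
    ((toGV kk z).1.val : ℤ) = z.1 ∧ ((toGV kk z).2.val : ℤ) = z.2 := by
  obtain ⟨h1, h2, h3, h4⟩ := h
  simp only [toGV]
  constructor
  · rw [Nat.mod_eq_of_lt (by omega)]; omega
  · rw [Nat.mod_eq_of_lt (by omega)]; omega

/-- The embedded horizontal endpoint. [folklore] -/
theorem ψ_toGV_gH (e : E (2 * kk + 1)) (h : InRange kk (gH kk e)) :
    ψ kk (toGV kk (gH kk e)) = hEnd e := by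
  have hv := toGV_val (gH kk e) h
  rw [hEnd, ψ_eq_inl_iff]
  have := e.2.1.isLt
  simp only [gH, InRange] at hv h ⊢
  omega

/-- The embedded vertical endpoint. [folklore] -/
theorem ψ_toGV_gV (e : E (2 * kk + 1)) (h : InRange kk (gV kk e)) :
    ψ kk (toGV kk (gV kk e)) = vEnd e := by
  have hv := toGV_val (gV kk e) h
  rw [vEnd, ψ_eq_inr_iff]
  have := e.2.2.isLt
  simp only [gV, InRange] at hv h ⊢
  omega

/-- A horizontal endpoint in the image of `ψ` has grid coordinates in range. [folklore] -/
theorem inRange_gH_of_eq (e : E (2 * kk + 1)) (v : GV kk) (h : ψ kk v = hEnd e) :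
    InRange kk (gH kk e) ∧ toGV kk (gH kk e) = v := by
  rw [hEnd, ψ_eq_inl_iff] at h
  have := v.1.isLt; have := v.2.isLt; have := e.2.1.isLt
  have hr : InRange kk (gH kk e) := by
    simp only [InRange, gH] at h ⊢; omega
  refine ⟨hr, ?_⟩
  have hv := toGV_val _ hr
  simp only [gH] at h hv
  refine Prod.ext (Fin.ext ?_) (Fin.ext ?_)
  · simp only [gH]; omega
  · simp only [gH]; omega

/-- A vertical endpoint in the image of `ψ` has grid coordinates in range. [folklore] -/
theorem inRange_gV_of_eq (e : E (2 * kk + 1)) (v : GV kk) (h : ψ kk v = vEnd e) :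
    InRange kk (gV kk e) ∧ toGV kk (gV kk e) = v := by
  rw [vEnd, ψ_eq_inr_iff] at h
  have := v.1.isLt; have := v.2.isLt; have := e.2.2.isLt
  have hr : InRange kk (gV kk e) := by
    simp only [InRange, gV] at h ⊢; omega
  refine ⟨hr, ?_⟩
  have hv := toGV_val _ hr
  simp only [gV] at h hv
  refine Prod.ext (Fin.ext ?_) (Fin.ext ?_)
  · simp only [gV]; omega
  · simp only [gV]; omega

/-- `ψ` is injective. [folklore] -/
theorem ψ_injective : Function.Injective (ψ kk) := by
  intro v w h
  have := v.1.isLt; have := v.2.isLt; have := w.1.isLt; have := w.2.isLt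
  rcases hw : ψ kk w with ⟨x, y⟩ | ⟨p, y⟩
  · rw [hw, ψ_eq_inl_iff] at h
    rw [ψ_eq_inl_iff] at hw
    ext <;> omega
  · rw [hw, ψ_eq_inr_iff] at h
    rw [ψ_eq_inr_iff] at hw
    ext <;> omega

/-- A pair of integers equal to the coordinates of a grid vertex is in range and clamps to it. [folklore] -/
theorem inRange_and_toGV_eq (z : ℤ × ℤ) (u : GV kk) (h : z.1 = u.1.val ∧ z.2 = u.2.val) :
    InRange kk z ∧ toGV kk z = u := by
  have := u.1.isLt; have := u.2.isLt
  have hr : InRange kk z := by unfold InRange; omega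
  refine ⟨hr, ?_⟩
  have hv := toGV_val z hr
  refine Prod.ext (Fin.ext ?_) (Fin.ext ?_) <;> omega

/-- Core of the edge construction: an even grid vertex and an adjacent vertex are the endpoints of
an edge of the Aztec diamond. [cite: Propp2003, §1.2] -/
theorem exists_edge_of_adj4_even (w z : GV kk) (hw : (w.1.val + w.2.val) % 2 = 0) (h : Adj4 w z) :
    ∃ e : E (2 * kk + 1), ((gH kk e).1 = w.1.val ∧ (gH kk e).2 = w.2.val) ∧
      ((gV kk e).1 = z.1.val ∧ (gV kk e).2 = z.2.val) := by
  have := w.1.isLt; have := w.2.isLt; have := z.1.isLt; have := z.2.isLt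
  rcases h with ⟨h1, h2⟩ | ⟨h1, h2⟩ | ⟨h1, h2⟩ | ⟨h1, h2⟩
  · refine ⟨((⟨(w.1.val + w.2.val) / 2, by omega⟩, ⟨(w.1.val + 2 * kk - w.2.val) / 2, by omega⟩),
      (0, 1)), ?_, ?_⟩ <;> simp only [gH, gV, Fin.val_zero, Fin.val_one] <;> omega
  · refine ⟨((⟨(w.1.val + w.2.val) / 2 - 1, by omega⟩, ⟨(w.1.val + 2 * kk - w.2.val) / 2, by omega⟩),
      (1, 0)), ?_, ?_⟩ <;> simp only [gH, gV, Fin.val_zero, Fin.val_one] <;> omega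
  · refine ⟨((⟨(w.1.val + w.2.val) / 2, by omega⟩, ⟨(w.1.val + 2 * kk - w.2.val) / 2, by omega⟩),
      (0, 0)), ?_, ?_⟩ <;> simp only [gH, gV, Fin.val_zero] <;> omega
  · refine ⟨((⟨(w.1.val + w.2.val) / 2 - 1, by omega⟩, ⟨(w.1.val + 2 * kk - w.2.val) / 2, by omega⟩),
      (1, 1)), ?_, ?_⟩ <;> simp only [gH, gV, Fin.val_one] <;> omega

/-- Adjacent grid vertices have coordinate sums of opposite parities. [folklore] -/
theorem parity_of_adj4 (u v : GV kk) (h : Adj4 u v) :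
    (u.1.val + u.2.val) % 2 ≠ (v.1.val + v.2.val) % 2 := by
  rcases h with ⟨h1, h2⟩ | ⟨h1, h2⟩ | ⟨h1, h2⟩ | ⟨h1, h2⟩ <;> omega

/-- `Adj4` is symmetric. [folklore] -/
theorem adj4_symm {N : ℕ} (u v : Fin N × Fin N) (h : Adj4 u v) : Adj4 v u := by
  rcases h with h | h | h | h
  · exact Or.inr (Or.inl ⟨h.1, h.2.symm⟩)
  · exact Or.inl ⟨h.1, h.2.symm⟩
  · exact Or.inr (Or.inr (Or.inr ⟨h.1.symm, h.2⟩))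
  · exact Or.inr (Or.inr (Or.inl ⟨h.1.symm, h.2⟩))

/-- **Grid edges are Aztec edges.** Adjacent grid vertices are the clamped endpoints of an edge of
the Aztec diamond with both endpoints in range. [cite: Propp2003, §1.2] -/
theorem exists_edge_of_adj4 (u v : GV kk) (h : Adj4 u v) :
    ∃ e : E (2 * kk + 1), InRange kk (gH kk e) ∧ InRange kk (gV kk e) ∧
      ((toGV kk (gH kk e) = u ∧ toGV kk (gV kk e) = v) ∨ (toGV kk (gH kk e) = v ∧ toGV kk (gV kk e) = u)) := by
  by_cases hu : (u.1.val + u.2.val) % 2 = 0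
  · obtain ⟨e, he1, he2⟩ := exists_edge_of_adj4_even u v hu h
    obtain ⟨a1, a2⟩ := inRange_and_toGV_eq _ _ he1
    obtain ⟨b1, b2⟩ := inRange_and_toGV_eq _ _ he2
    exact ⟨e, a1, b1, Or.inl ⟨a2, b2⟩⟩
  · have hv : (v.1.val + v.2.val) % 2 = 0 := by have := parity_of_adj4 u v h; omega
    obtain ⟨e, he1, he2⟩ := exists_edge_of_adj4_even v u hv (adj4_symm u v h)
    obtain ⟨a1, a2⟩ := inRange_and_toGV_eq _ _ he1
    obtain ⟨b1, b2⟩ := inRange_and_toGV_eq _ _ he2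
    exact ⟨e, a1, b1, Or.inr ⟨a2, b2⟩⟩

/-- The clamped endpoints of an in-range edge are adjacent in the grid. [cite: Propp2003, §1.2] -/
theorem adj4_of_edge (e : E (2 * kk + 1)) (h1 : InRange kk (gH kk e)) (h2 : InRange kk (gV kk e)) :
    Adj4 (toGV kk (gH kk e)) (toGV kk (gV kk e)) := by
  have a := toGV_val _ h1
  have b := toGV_val _ h2
  have hg : (gV kk e).1 - (gH kk e).1 = (e.2.2.val : ℤ) - e.2.1.val ∧
      (gV kk e).2 - (gH kk e).2 = 1 - (e.2.2.val : ℤ) - e.2.1.val := by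
    simp only [gH, gV]; omega
  have := e.2.1.isLt; have := e.2.2.isLt
  unfold Adj4
  omega

/-- Horizontal and vertical clamped endpoints never coincide (parity). [folklore] -/
theorem toGV_gH_ne_toGV_gV (e e' : E (2 * kk + 1)) (h1 : InRange kk (gH kk e)) (h2 : InRange kk (gV kk e')) :
    toGV kk (gH kk e) ≠ toGV kk (gV kk e') := by
  intro h
  have a := toGV_val _ h1
  have b := toGV_val _ h2
  rw [h] at a
  simp only [gH, gV] at a b
  omega

/-- An edge is determined by its two endpoints. [folklore] -/
theorem edge_eq_of_ends {m : ℕ} (e e' : E m) (h1 : hEnd e = hEnd e') (h2 : vEnd e = vEnd e') : e = e' := by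
  obtain ⟨⟨p, q⟩, ⟨δ, ε⟩⟩ := e
  obtain ⟨⟨p', q'⟩, ⟨δ', ε'⟩⟩ := e'
  simp only [hEnd, vEnd, Sum.inl.injEq, Sum.inr.injEq, Prod.mk.injEq, Fin.ext_iff] at h1 h2
  have := δ.isLt; have := δ'.isLt; have := ε.isLt; have := ε'.isLt
  simp only [Prod.mk.injEq, Fin.ext_iff]
  omega

end Square

end

end SquareGridDimers

end Summit.ValiantsHypothesis.ValiantsHypothesis.Theorems
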